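import Summits.Ventures.PercRepro.ProfileGapMonoThresholdWeakAvgCount

/-!
# PercRepro — THE SHARES OF THE WEAK AVERAGED STEP AT CO-RANK `2`, GENERIC IN THE THRESHOLD `t`
(p5, gen 28; `proofs/P5-GM1.md` §29(a))

The charging of `ProfileGapMonoThresholdWeakAverageCharge` (`t = 3`) typed once for every co-rank threshold `t`:
a rank-`1` set `B` (class `P = clF N B`) with `ρ(E∖B) ≥ t + 1` claims, from each up-set `S = insert y B`
(`y ∉ P`; `S ∈ T_t` by `insert_mem_levelSetCoQ_of_rankOne_gen`), the HALF `h_t(S)` of the weight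
`2 h_t(S)`, `h_t(S) := #S + [ρ(E∖S) = t] κ(E∖S)`, when `B` is a singleton whose partner `{y}` is itself demanding
(`ρ(E∖y) ≥ t + 1`), and the WHOLE `2 h_t(S)` otherwise.  VALIDITY (`sum_share_le_sum_weight_gen`): an up-set has
at most two claimants (`eq_singleton_of_insert_eq`, `t`-free), and two claimants are two demanding singletons,
each taking the half (`sum_mult_fibre_le_two_gen`).  Nothing here is asserted about the averaged step itself.
-/

open scoped Matroid

namespace PercRepro.Cogirth

open Finset ThmH Skew Shadow Profile

variable {α : Type} [DecidableEq α] {N : Matroid α} [N.Finite]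

section Validity

/-- **The multiplicities of one up-set sum to at most `2`, every threshold**: over the pairs `(B, y)` with
`ρ(E∖B) ≥ t + 1` and `insert y B = S`, `Σ (if #B = 1 ∧ t + 1 ≤ ρ(E∖y) then 1 else 2) ≤ 2`. -/
theorem sum_mult_fibre_le_two_gen (hloop : ∀ x ∈ gr N, rk N {x} = 1) (t : ℕ) (S : Finset α) :
    ∑ p ∈ (((Rq N 1).filter (fun B => t + 1 ≤ rk N (gr N \ B))).sigma (fun B => gr N \ clF N B)).filter
        (fun p : (Σ _ : Finset α, α) => insert p.2 p.1 = S),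
      (if p.1.card = 1 ∧ t + 1 ≤ rk N (gr N \ {p.2}) then 1 else 2) ≤ 2 := by
  set F := (((Rq N 1).filter (fun B => t + 1 ≤ rk N (gr N \ B))).sigma (fun B => gr N \ clF N B)).filter
    (fun p : (Σ _ : Finset α, α) => insert p.2 p.1 = S) with hF
  -- membership in `F`, unpacked
  have hmem : ∀ p ∈ F, p.1 ∈ Rq N 1 ∧ t + 1 ≤ rk N (gr N \ p.1) ∧ p.2 ∈ gr N \ clF N p.1 ∧
      insert p.2 p.1 = S := by
    intro p hp
    rw [hF, mem_filter, mem_sigma, mem_filter] at hp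
    exact ⟨hp.1.1.1, hp.1.1.2, hp.1.2, hp.2⟩
  by_cases hcard : F.card ≤ 1
  · calc ∑ p ∈ F, (if p.1.card = 1 ∧ t + 1 ≤ rk N (gr N \ {p.2}) then 1 else 2)
        ≤ ∑ _p ∈ F, 2 := sum_le_sum (fun p _ => by split_ifs <;> omega)
      _ = F.card * 2 := by rw [sum_const, smul_eq_mul]
      _ ≤ 2 := by omega
  · push Not at hcard
    -- every pair of `F` is a singleton with a demanding partner: multiplicity `1`
    have hone : ∀ p ∈ F, (if p.1.card = 1 ∧ t + 1 ≤ rk N (gr N \ {p.2}) then 1 else 2) = 1 := by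
      intro p hp
      obtain ⟨p', hp', hne⟩ := exists_mem_ne hcard p
      obtain ⟨hB, _, hy, hS⟩ := hmem p hp
      obtain ⟨hB', ht', hy', hS'⟩ := hmem p' hp'
      have hne' : ¬ (p.1 = p'.1 ∧ p.2 = p'.2) := by
        rintro ⟨h1, h2⟩
        apply hne
        exact (Sigma.ext h1 (heq_of_eq h2)).symm
      have hsing : p.1 = {p'.2} :=
        eq_singleton_of_insert_eq hloop hB hB' hy hy' (hS.trans hS'.symm) hne'
      have hsing' : p'.1 = {p.2} :=
        eq_singleton_of_insert_eq hloop hB' hB hy' hy (hS'.trans hS.symm)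
          (fun h => hne' ⟨h.1.symm, h.2.symm⟩)
      rw [if_pos ⟨by rw [hsing, card_singleton], by rw [← hsing']; exact ht'⟩]
    rw [sum_congr rfl hone, sum_const, smul_eq_mul, mul_one]
    -- `F` injects into `S`, which has two elements
    obtain ⟨p₀, hp₀⟩ : F.Nonempty := by
      rw [← card_pos]; omega
    obtain ⟨p₁, hp₁, hne₁⟩ := exists_mem_ne hcard p₀
    obtain ⟨hB₀, _, hy₀, hS₀⟩ := hmem p₀ hp₀
    obtain ⟨hB₁, _, hy₁, hS₁⟩ := hmem p₁ hp₁
    have hsing₀ : p₀.1 = {p₁.2} :=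
      eq_singleton_of_insert_eq hloop hB₀ hB₁ hy₀ hy₁ (hS₀.trans hS₁.symm)
        (by rintro ⟨h1, h2⟩; exact hne₁ (Sigma.ext h1 (heq_of_eq h2)).symm)
    have hScard : S.card ≤ 2 := by
      rw [← hS₀, hsing₀]
      have h := card_insert_le p₀.2 ({p₁.2} : Finset α)
      rw [card_singleton] at h
      exact h
    refine le_trans (card_le_card_of_injOn (fun p : (Σ _ : Finset α, α) => p.2) ?_ ?_) hScard
    · intro p hp
      rw [mem_coe] at hp
      rw [mem_coe, ← (hmem p hp).2.2.2]
      exact mem_insert_self _ _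
    · rintro ⟨B₁, y₁⟩ hp₁ ⟨B₂, y₂⟩ hp₂ heq
      simp only at heq
      subst heq
      rw [mem_coe] at hp₁ hp₂
      obtain ⟨hB₁', _, hy₁', hS₁'⟩ := hmem _ hp₁
      obtain ⟨hB₂', _, hy₂', hS₂'⟩ := hmem _ hp₂
      have hy₁B : y₁ ∉ B₁ := notMem_of_mem_sdiff_clF (mem_Rq.1 hB₁').1 hy₁'
      have hy₂B : y₁ ∉ B₂ := notMem_of_mem_sdiff_clF (mem_Rq.1 hB₂').1 hy₂'
      have hB : B₁ = B₂ := by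
        simp only at hS₁' hS₂'
        rw [← erase_insert hy₁B, ← erase_insert hy₂B, hS₁', hS₂']
      subst hB
      rfl

/-- **Validity of the shares, every threshold**: summed over the rank-`1` sets with `ρ(E∖B) ≥ t + 1`, the shares of
the up-sets never exceed the supply `Σ_{S ∈ T_t} 2 · h_t(S)`, `h_t(S) = #S + [ρ(E∖S) = t] κ(E∖S)`. -/
theorem sum_share_le_sum_weight_gen (hloop : ∀ x ∈ gr N, rk N {x} = 1) (t : ℕ) :
    ∑ B ∈ (Rq N 1).filter (fun B => t + 1 ≤ rk N (gr N \ B)), ∑ y ∈ gr N \ clF N B,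
        (if B.card = 1 ∧ t + 1 ≤ rk N (gr N \ {y}) then 1 else 2) *
          ((insert y B).card +
            (if rk N (gr N \ insert y B) = t then (coloops N (gr N \ insert y B)).card else 0)) ≤
      ∑ S ∈ levelSetCoQ N t 2,
        2 * (S.card + (if rk N (gr N \ S) = t then (coloops N (gr N \ S)).card else 0)) := by
  set L := (Rq N 1).filter (fun B => t + 1 ≤ rk N (gr N \ B)) with hL
  set Q := L.sigma (fun B => gr N \ clF N B) with hQ
  rw [← sum_sigma L (fun B => gr N \ clF N B)
    (fun p => (if p.1.card = 1 ∧ t + 1 ≤ rk N (gr N \ {p.2}) then 1 else 2) *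
      ((insert p.2 p.1).card +
        (if rk N (gr N \ insert p.2 p.1) = t then (coloops N (gr N \ insert p.2 p.1)).card else 0)))]
  have hmaps : ∀ p ∈ Q, insert p.2 p.1 ∈ levelSetCoQ N t 2 := by
    rintro ⟨B, y⟩ hp
    rw [hQ, mem_sigma, hL, mem_filter] at hp
    exact insert_mem_levelSetCoQ_of_rankOne_gen hp.1.1 hp.1.2 hp.2
  rw [← sum_fiberwise_of_maps_to hmaps]
  apply sum_le_sum
  intro S _
  -- on the fibre of `S` the weight factor is constant: `h_t(S)`
  rw [sum_congr rfl (fun p hp => by rw [(mem_filter.1 hp).2]), ← sum_mul]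
  apply Nat.mul_le_mul_right
  exact sum_mult_fibre_le_two_gen hloop t S

end Validity

end PercRepro.Cogirth
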